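import Literature.AnabelianGeometry.AbsoluteAnabelian.MLFReciprocityCharacterizedProofs
import HarnessLib

/-!
# Reciprocity at a finite Galois level `E₀ ⊆ F̄`: range, units and Frobenius read off `θ_E`

Proof-only companion (abc-iut layer L4, sub-node `AbsAnab:Prop1.2.1(vii)/L02 UnitsTransport` of
`plan/L4/SUBDAG-AbsAnab-Prop121vii.md`).  S. Mochizuki, *The Absolute Anabelian Geometry of
Hyperbolic Curves* (2004) [AbsAnab], §1.2 p. 9 and proof of Prop 1.2.1 p. 11: local class field
theory gives `(K^×)^∧ ⥲ G_K^{ab}`, and "the image `Im(𝒪^×_K)`", "the image `Im(K^×)`", "the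
Frobenius element" are the LCFT data the proof of Prop 1.2.1 (iii)/(iv)/(vii) reads off it.

For a finite Galois extension `E/F` of non-archimedean local fields and ANY homomorphism
`Art : E₀ˣ → Gal(F̄/E₀)^ab` (`E₀ = ι⁻¹(E) ⊆ F̄`, `embField F E`) characterised by the finite abelian
shadows of Serre's `θ_E` — the characterisation clause of
`exists_reciprocity_characterized_embField` (abc-iut-L6-t11 / abc-iut-L4-t11), also the hypothesis
of the local transfer theorem `verlagerung_apply_eq_of_characterized` — this file reads the
`IsLocalReciprocityMap` properties of the tree's canonical `θ_E`
(`(isReciprocitySystemE _).theta`, Serre XIII §4 / XIV §6) back through the characterisation: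

* `levelArt_eq_mk_iff_theta` — `Art u = [h] ↔ [liftGal h] = θ_E (ι u)`;
* `liftGal_mem_weil_sup_of_levelArt_eq` / `exists_levelArt_eq_mk_of_mem_weil_sup` — the image of
  `Art` is the image of the Weil group: representatives lie in `W_E · [Γ_E, Γ_E]⁻`, and every such
  class is a value ("`Im(K^×)`");
* `liftGal_mem_inertia_sup_iff_of_levelArt_eq` — `Art u ∈ [I_E · [Γ_E,Γ_E]⁻] ↔ u` is a unit
  ("`Im(𝒪^×_K)` … is equal to the image of `I_K`", p. 11);
* `isFrobPow_liftGal_of_levelArt_eq`, `isUniformizer_of_levelArt_eq_of_isFrobPow` — uniformisers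
  correspond to arithmetic Frobenius classes ("the Frobenius element", p. 10).

No definitions, no new named facts; classical LCFT only (Serre, *Local Fields* XIII–XIV).  HONEST
FRAMING: nothing here bears on [IUTchIII] Cor. 3.12.
-/

noncomputable section

open Field IsNonarchimedeanLocalField ValuativeRel
open scoped Pointwise

namespace Literature.AnabelianGeometry.AbsoluteAnabelian

open Literature.NumberTheory.GaloisRepresentations
open Literature.NumberTheory.GaloisRepresentations.LocalWeilDatum
open AbstractCFT AbstractCFT.WeilDatum

section Level

variable {F E : Type*} [Field F] [ValuativeRel F] [TopologicalSpace F] [IsNonarchimedeanLocalField F]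
  [Field E] [Algebra F E] [FiniteDimensional F E] [Algebra.IsSeparable F E]
  [ValuativeRel E] [TopologicalSpace E] [IsNonarchimedeanLocalField E] [ValuativeExtension F E]
  {Art : (embField F E)ˣ →* TopologicalAbelianization (galFixing F (embField F E))}

/-- **`Art u = [h] ↔ [liftGal h] = θ_E (ι u)`**: a homomorphism `Art : E₀ˣ → Gal(F̄/E₀)^ab`
characterised by the finite abelian shadows `(ι u, L'/E)` of Serre's reciprocity map IS `θ_E`
transported along `Gal(F̄/E₀) ≅ Γ_E` ([AbsAnab] §1.2 p. 9 "we have a natural isomorphism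
`(K^×)^∧ ⥲ G^{ab}_K`"; Cassels–Fröhlich VI §2.3, `θ` is determined by its shadows).
[cite: MochizukiAbsAnab2004, §1.2 p.9] -/
theorem levelArt_eq_mk_iff_theta
    (hchar : ∀ (u : (embField F E)ˣ) (h : galFixing F (embField F E)),
      Art u = QuotientGroup.mk h ↔
        ∀ (L' : IntermediateField E (AlgebraicClosure E)) [FiniteDimensional E L']
            [IsAbelianGalois E L'],
          AlgEquiv.restrictNormalHom L' (absoluteGaloisGroup.toAlgEquiv E (liftGal F E h.2)) =
            recSystemE (isClassFieldTheory_localWeilDatum F) L'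
              (Units.map ((equivEmbField F E).symm : embField F E →* E) u))
    (u : (embField F E)ˣ) (h : galFixing F (embField F E)) :
    Art u = QuotientGroup.mk h ↔
      absGaloisAbProj E (liftGal F E h.2) =
        (isReciprocitySystemE (F := F) (E := E) (isClassFieldTheory_localWeilDatum F)).theta
          (Units.map ((equivEmbField F E).symm : embField F E →* E) u) := by
  rw [hchar u h, (isReciprocitySystemE (F := F) (E := E)
    (isClassFieldTheory_localWeilDatum F)).absGaloisAbProj_eq_theta_iff,
    IsReciprocitySystem.mem_reps_iff]

/-- Serre's `θ_E` (the tree's canonical reciprocity map of the local field `E`) has the printed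
properties: injective, image `=` image of the Weil group, units `↔` inertia, uniformisers `↦`
Frobenius (`IsLocalReciprocityMap`; Serre XIII §4, XIV §6). [cite: MochizukiAbsAnab2004, §1.2 p.9] -/
theorem isLocalReciprocityMap_levelTheta :
    IsLocalReciprocityMap E
      (isReciprocitySystemE (F := F) (E := E) (isClassFieldTheory_localWeilDatum F)).theta :=
  (isReciprocitySystemE (F := F) (E := E) (isClassFieldTheory_localWeilDatum F)).isLocalReciprocityMap_theta
    (universalNormSubgroup_eq_bot E) (isClosed_of_isNormSubgroup_holds E)

omit [ValuativeRel E] [TopologicalSpace E] [IsNonarchimedeanLocalField E] [ValuativeExtension F E]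
  [FiniteDimensional F E] [Algebra.IsSeparable F E] in
/-- `σ ∈ H · [Γ_E, Γ_E]⁻ ↔ [σ] ∈ [H]` in `Γ_E^{ab}` (the kernel of `Γ_E → Γ_E^{ab}` is the closed
commutator subgroup). [cite: MochizukiAbsAnab2004, Prop 1.2.1 (iii) p.10] -/
theorem mem_sup_closureCommutator_iff_absGaloisAbProj_mem (H : Subgroup (absoluteGaloisGroup E))
    (σ : absoluteGaloisGroup E) :
    σ ∈ H ⊔ (commutator (absoluteGaloisGroup E)).topologicalClosure ↔
      absGaloisAbProj E σ ∈ H.map (absGaloisAbProj E) := by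
  have hker := Subgroup.comap_map_eq (absGaloisAbProj E) H
  rw [QuotientGroup.ker_mk'] at hker
  rw [← hker, Subgroup.mem_comap]

/-- **"`Im(K^×)`" — representatives of values of `Art` lie in `W_E · [Γ_E, Γ_E]⁻`** (the image of
`θ_E` is the image of the Weil group, Serre XIV §6 Remark 2; [AbsAnab] Prop 1.2.1 (iii) "the image
`Im(K^×)`"). [cite: MochizukiAbsAnab2004, Prop 1.2.1 (iii) p.10] -/
theorem liftGal_mem_weil_sup_of_levelArt_eq
    (hchar : ∀ (u : (embField F E)ˣ) (h : galFixing F (embField F E)),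
      Art u = QuotientGroup.mk h ↔
        ∀ (L' : IntermediateField E (AlgebraicClosure E)) [FiniteDimensional E L']
            [IsAbelianGalois E L'],
          AlgEquiv.restrictNormalHom L' (absoluteGaloisGroup.toAlgEquiv E (liftGal F E h.2)) =
            recSystemE (isClassFieldTheory_localWeilDatum F) L'
              (Units.map ((equivEmbField F E).symm : embField F E →* E) u))
    {u : (embField F E)ˣ} {h : galFixing F (embField F E)} (H : Art u = QuotientGroup.mk h) :
    liftGal F E h.2 ∈ weilSubgroup E ⊔ (commutator (absoluteGaloisGroup E)).topologicalClosure := by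
  rw [mem_sup_closureCommutator_iff_absGaloisAbProj_mem,
    ← (isLocalReciprocityMap_levelTheta (F := F) (E := E)).range_eq,
    (levelArt_eq_mk_iff_theta hchar u h).mp H]
  exact ⟨_, rfl⟩

/-- **Every class of `W_E · [Γ_E, Γ_E]⁻` is a value of `Art`** (surjectivity of `θ_E` onto the image
of the Weil group, Serre XIV §6 Remark 2). [cite: MochizukiAbsAnab2004, Prop 1.2.1 (iii) p.10] -/
theorem exists_levelArt_eq_mk_of_mem_weil_sup
    (hchar : ∀ (u : (embField F E)ˣ) (h : galFixing F (embField F E)),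
      Art u = QuotientGroup.mk h ↔
        ∀ (L' : IntermediateField E (AlgebraicClosure E)) [FiniteDimensional E L']
            [IsAbelianGalois E L'],
          AlgEquiv.restrictNormalHom L' (absoluteGaloisGroup.toAlgEquiv E (liftGal F E h.2)) =
            recSystemE (isClassFieldTheory_localWeilDatum F) L'
              (Units.map ((equivEmbField F E).symm : embField F E →* E) u))
    (h : galFixing F (embField F E))
    (hw : liftGal F E h.2 ∈ weilSubgroup E ⊔ (commutator (absoluteGaloisGroup E)).topologicalClosure) :
    ∃ u : (embField F E)ˣ, Art u = QuotientGroup.mk h := by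
  rw [mem_sup_closureCommutator_iff_absGaloisAbProj_mem,
    ← (isLocalReciprocityMap_levelTheta (F := F) (E := E)).range_eq] at hw
  obtain ⟨x, hx⟩ := hw
  refine ⟨Units.map (equivEmbField F E : E →* embField F E) x, ?_⟩
  rw [levelArt_eq_mk_iff_theta hchar, ← hx]
  congr 1
  ext
  simp

/-- **"`Im(𝒪^×_K)` is equal to the image of `I_K`"** ([AbsAnab] Prop 1.2.1 proof p. 11; Serre XIII
§4 Cor. to Prop. 13, `θ(U_E) = 𝔗_E`): for `Art u = [h]`, the representative `liftGal h` lies in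
`I_E · [Γ_E, Γ_E]⁻` iff `ι u` is a unit of `𝒪_E`. [cite: MochizukiAbsAnab2004, Prop 1.2.1 (iii) p.11] -/
theorem liftGal_mem_inertia_sup_iff_of_levelArt_eq
    (hchar : ∀ (u : (embField F E)ˣ) (h : galFixing F (embField F E)),
      Art u = QuotientGroup.mk h ↔
        ∀ (L' : IntermediateField E (AlgebraicClosure E)) [FiniteDimensional E L']
            [IsAbelianGalois E L'],
          AlgEquiv.restrictNormalHom L' (absoluteGaloisGroup.toAlgEquiv E (liftGal F E h.2)) =
            recSystemE (isClassFieldTheory_localWeilDatum F) L'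
              (Units.map ((equivEmbField F E).symm : embField F E →* E) u))
    {u : (embField F E)ˣ} {h : galFixing F (embField F E)} (H : Art u = QuotientGroup.mk h) :
    liftGal F E h.2 ∈ absInertia E ⊔ (commutator (absoluteGaloisGroup E)).topologicalClosure ↔
      Units.map ((equivEmbField F E).symm : embField F E →* E) u ∈
        (valuation E).valuationSubring.unitGroup := by
  have hθ := isLocalReciprocityMap_levelTheta (F := F) (E := E)
  have H' := (levelArt_eq_mk_iff_theta hchar u h).mp H
  rw [mem_sup_closureCommutator_iff_absGaloisAbProj_mem, H', ← hθ.map_unitGroup, Subgroup.mem_map]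
  constructor
  · rintro ⟨y, hy, hyx⟩
    rwa [← hθ.injective hyx]
  · intro hx
    exact ⟨_, hx, rfl⟩

/-- **Uniformisers go to Frobenius classes** ("the Frobenius element", [AbsAnab] §1.2 p. 10; Serre
XIII §4 Prop. 13, arithmetic normalisation): if `ι u` is a uniformiser of `E` and `Art u = [h]`,
then `liftGal h` is an arithmetic Frobenius of `Γ_E`. [cite: MochizukiAbsAnab2004, Prop 1.2.1 (iv) p.10] -/
theorem isFrobPow_liftGal_of_levelArt_eq
    (hchar : ∀ (u : (embField F E)ˣ) (h : galFixing F (embField F E)),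
      Art u = QuotientGroup.mk h ↔
        ∀ (L' : IntermediateField E (AlgebraicClosure E)) [FiniteDimensional E L']
            [IsAbelianGalois E L'],
          AlgEquiv.restrictNormalHom L' (absoluteGaloisGroup.toAlgEquiv E (liftGal F E h.2)) =
            recSystemE (isClassFieldTheory_localWeilDatum F) L'
              (Units.map ((equivEmbField F E).symm : embField F E →* E) u))
    {u : (embField F E)ˣ} {h : galFixing F (embField F E)} (H : Art u = QuotientGroup.mk h)
    (hϖ : (valuation E).IsUniformizer
      ((Units.map ((equivEmbField F E).symm : embField F E →* E) u : Eˣ) : E)) :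
    IsFrobPow (liftGal F E h.2) 1 :=
  isLocalReciprocityMap_levelTheta.isFrobPow_one_of_isUniformizer _ hϖ _
    ((levelArt_eq_mk_iff_theta hchar u h).mp H)

/-- **Frobenius classes come from uniformisers** (converse direction; Serre XIII §4 Prop. 13 with
`θ(U_E) = 𝔗_E` and injectivity): if `Art u = [h]` with `liftGal h` an arithmetic Frobenius, then
`ι u` is a uniformiser of `E` (two Frobenius elements differ by inertia, so `ι u / ϖ` is a unit for
any uniformiser `ϖ`). [cite: MochizukiAbsAnab2004, Prop 1.2.1 (iv) p.10] -/
theorem isUniformizer_of_levelArt_eq_of_isFrobPow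
    (hchar : ∀ (u : (embField F E)ˣ) (h : galFixing F (embField F E)),
      Art u = QuotientGroup.mk h ↔
        ∀ (L' : IntermediateField E (AlgebraicClosure E)) [FiniteDimensional E L']
            [IsAbelianGalois E L'],
          AlgEquiv.restrictNormalHom L' (absoluteGaloisGroup.toAlgEquiv E (liftGal F E h.2)) =
            recSystemE (isClassFieldTheory_localWeilDatum F) L'
              (Units.map ((equivEmbField F E).symm : embField F E →* E) u))
    {u : (embField F E)ˣ} {h : galFixing F (embField F E)} (H : Art u = QuotientGroup.mk h)
    (hfrob : IsFrobPow (liftGal F E h.2) 1) :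
    (valuation E).IsUniformizer
      ((Units.map ((equivEmbField F E).symm : embField F E →* E) u : Eˣ) : E) := by
  have hθ := isLocalReciprocityMap_levelTheta (F := F) (E := E)
  have H' := (levelArt_eq_mk_iff_theta hchar u h).mp H
  set x : Eˣ := Units.map ((equivEmbField F E).symm : embField F E →* E) u with hx
  obtain ⟨ϖ, hϖ⟩ : ∃ ϖ : Eˣ, (valuation E).IsUniformizer (ϖ : E) := exists_units_isUniformizer
  obtain ⟨γ, hγ⟩ := QuotientGroup.mk_surjective
    ((isReciprocitySystemE (F := F) (E := E) (isClassFieldTheory_localWeilDatum F)).theta ϖ)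
  have hγ1 : IsFrobPow γ 1 := hθ.isFrobPow_one_of_isUniformizer ϖ hϖ γ hγ
  have hI : liftGal F E h.2 * γ⁻¹ ∈ absInertia E :=
    IsFrobPow.mul_inv_mem_absInertia_holds hfrob hγ1
  have hmem : (isReciprocitySystemE (F := F) (E := E) (isClassFieldTheory_localWeilDatum F)).theta
      (x * ϖ⁻¹) ∈ (absInertia E).map (absGaloisAbProj E) := by
    refine ⟨_, hI, ?_⟩
    rw [map_mul, map_inv, map_mul, map_inv, H', hx]
    exact congrArg₂ (· * ·) rfl (congrArg (·⁻¹) hγ)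
  rw [← hθ.map_unitGroup, Subgroup.mem_map] at hmem
  obtain ⟨y, hy, hyx⟩ := hmem
  rw [hθ.injective hyx, Valuation.mem_unitGroup_iff, Units.val_mul, Units.val_inv_eq_inv_val,
    map_mul, map_inv₀] at hy
  have hϖ0 : valuation E (ϖ : E) ≠ 0 := (Valuation.ne_zero_iff _).mpr ϖ.ne_zero
  have hxϖ : valuation E (x : E) = valuation E (ϖ : E) := (mul_inv_eq_one₀ hϖ0).mp hy
  change valuation E (x : E) = _
  rw [hxϖ]
  exact hϖ

end Level

end Literature.AnabelianGeometry.AbsoluteAnabelian
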